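import Mathlib.LinearAlgebra.Lagrange
import Mathlib.Algebra.CharZero.Infinite
import Mathlib.Data.Fintype.EquivFin
import Mathlib.Algebra.MvPolynomial.Monad
import Literature.RepresentationTheory.GeneralLinear.OrbitLatticeCoinvariants
import HarnessLib

/-!
# The integral lattice of an orbit closure is a hyperalgebra module

Sequel to `OrbitLatticeCoinvariants.lean` (definition request `defn-hyperalgebraCoinvariants`,
route ValiantsHypothesis/IntegralGCT): the proofs that make `Λ_{f,d} = ℤ[V]_d ⧸ K_{f,d}` an
honest quotient `KostantModule` and identify the route's certificate
`d_p(f; d, λ) = orbitTorsionRank f m d p λ` with its `torsionRank`; also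
`orbitLatticeDegEquiv : Λ_{f,d} ≃ Λ(f,d)`.

* Change of scalars: `map φ ∘ linSubst A = linSubst (A.map φ) ∘ map φ`,
  `map φ ∘ coordSubst m g = coordSubst m (g.map φ) ∘ map φ`, transvections and `tCoeff` are
  compatible with ring maps; specialising `t ↦ c` in `u_ij(t) · F` gives the finite Taylor sum
  `Σ_l c^l E_ij^(l) F` (`map_evalRingHom_eq_sum`); `E_ij^(0) = 1` (`coordDivPow_zero`);
* Vandermonde extraction (`mem_of_sum_pow_smul_mem`, by Lagrange interpolation): if
  `Σ_l c_i^l • w_l ∈ S` for `D + 1` distinct scalars then every `w_l ∈ S`.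
* Over an INFINITE field `k` the vanishing ideal `I(GL·f)` is stable under every `E_ij^(l)`
  (`tCoeff_coordSubst_transvection_mem`: `u_ij(c) · F ∈ I` for all `c ∈ k`, then extract
  coefficients), hence `K_f` is stable (`isStable_orbitLatticeKer`), `Λ_{f,d}` is the quotient
  Kostant module `orbitKostantModule f m d`, and
  `orbitTorsionRank f m d p λ = (orbitKostantModule f m d).torsionRank p λ`
  (`orbitTorsionRank_eq_torsionRank`).

Sources: Jantzen 2003, I.7.8–7.12, II.1.12 (hyperalgebra action through the comodule map, which is
what the `t`-expansion formalises); Humphreys 1972 §27.1. Not here: weight shifts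
`E_ij^(l) R[V]_μ ⊆ R[V]_{μ + l(ε_i - ε_j)}`, the binomial formula on generators, and the
monotonicity of `d_p` along lattice-preserving intertwiners of `k[Δ f]_d` (which combines
`tCoeff_coordSubst_transvection_mem`, Vandermonde and `KostantModule.torsionRank_le_of_surjective`).
-/

noncomputable section


namespace Literature.RepresentationTheory.GeneralLinear

open MvPolynomial Literature.Computability.AlgebraicComplexity
open scoped Polynomial

section BaseChange

variable {σ : Type*} [Fintype σ] [DecidableEq σ] {R S : Type*} [CommRing R] [CommRing S]

omit [DecidableEq σ] in
/-- Linear substitution commutes with change of scalars. [folklore] -/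
theorem map_linSubst (φ : R →+* S) (A : Matrix σ σ R) (p : MvPolynomial σ R) :
    map φ (linSubst σ R A p) = linSubst σ S (A.map φ) (map φ p) := by
  have h : ∀ i, map φ (∑ j, A j i • X j : MvPolynomial σ R) =
      ∑ j, (A.map φ) j i • (X j : MvPolynomial σ S) := fun i => by
    simp only [map_sum, smul_eq_C_mul, map_mul, map_C, map_X, Matrix.map_apply]
  simp only [linSubst, aeval_eq_bind₁, map_bind₁, h]

/-- The matrix of the image of a `GL` element under change of scalars. [folklore] -/
theorem coe_generalLinearGroup_map (φ : R →+* S) (g : GL σ R) :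
    ((Matrix.GeneralLinearGroup.map φ g : GL σ S) : Matrix σ σ S) = (g : Matrix σ σ R).map φ :=
  rfl

/-- `coordSubst` commutes with change of scalars:
`map φ ∘ coordSubst m g = coordSubst m (g.map φ) ∘ map φ`. [folklore] -/
theorem map_coordSubst (φ : R →+* S) (m : ℕ) (g : GL σ R) (F : MvPolynomial (DegIdx σ m) R) :
    map φ (coordSubst m g F) =
      coordSubst m (Matrix.GeneralLinearGroup.map φ g) (map φ F) := by
  have hc : ∀ d e : DegIdx σ m, φ (coeff d.1 (linSubstRep σ R g⁻¹ (monomial e.1 1))) =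
      coeff d.1 (linSubstRep σ S (Matrix.GeneralLinearGroup.map φ g)⁻¹ (monomial e.1 1)) := by
    intro d e
    rw [linSubstRep_apply, linSubstRep_apply, ← map_inv, coe_generalLinearGroup_map, ← coeff_map,
      map_linSubst, map_monomial, map_one]
  have h : ∀ d : DegIdx σ m,
      map φ (∑ e, coeff d.1 (linSubstRep σ R g⁻¹ (monomial e.1 1)) • X e :
        MvPolynomial (DegIdx σ m) R) =
      ∑ e, coeff d.1 (linSubstRep σ S (Matrix.GeneralLinearGroup.map φ g)⁻¹ (monomial e.1 1)) •
        (X e : MvPolynomial (DegIdx σ m) S) := fun d => by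
    simp only [map_sum, smul_eq_C_mul, map_mul, map_C, map_X, hc]
  simp only [coordSubst, aeval_eq_bind₁, map_bind₁, h]

/-- Transvections are compatible with change of scalars. [folklore] -/
theorem generalLinearGroup_map_transvectionGL (φ : R →+* S) {i j : σ} (h : i ≠ j) (c : R) :
    Matrix.GeneralLinearGroup.map φ (transvectionGL h c) = transvectionGL h (φ c) := by
  refine Units.ext ?_
  rw [coe_generalLinearGroup_map, coe_transvectionGL, coe_transvectionGL]
  ext a b
  simp only [Matrix.map_apply, Matrix.transvection, Matrix.add_apply, Matrix.one_apply,
    Matrix.single_apply, map_add, apply_ite φ, map_one, map_zero]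

variable {ι : Type*}

/-- `tCoeff` commutes with change of scalars. [folklore] -/
theorem map_tCoeff (φ : R →+* S) (k : ℕ) (P : MvPolynomial ι R[X]) :
    map φ (tCoeff k P) = tCoeff k (map (Polynomial.mapRingHom φ) P) := by
  ext n
  simp only [coeff_map, coeff_tCoeff, Polynomial.coe_mapRingHom, Polynomial.coeff_map]

/-- A bound for the `t`-degrees of all coefficients of `P ∈ R[t][V]`. [folklore] -/
def tDegreeBound (P : MvPolynomial ι R[X]) : ℕ :=
  P.support.sup fun n => (coeff n P).natDegree

/-- `tDegreeBound` bounds every coefficient degree. [folklore] -/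
theorem natDegree_coeff_le_tDegreeBound (P : MvPolynomial ι R[X]) (n : ι →₀ ℕ) :
    (coeff n P).natDegree ≤ tDegreeBound P := by
  by_cases hn : n ∈ P.support
  · exact Finset.le_sup (f := fun n => (coeff n P).natDegree) hn
  · rw [notMem_support_iff.1 hn, Polynomial.natDegree_zero]
    exact Nat.zero_le _

/-- `tCoeff l P = 0` beyond the degree bound. [folklore] -/
theorem tCoeff_eq_zero_of_lt (P : MvPolynomial ι R[X]) {l : ℕ} (hl : tDegreeBound P < l) :
    tCoeff l P = 0 := by
  ext n
  rw [coeff_tCoeff, coeff_zero]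
  exact Polynomial.coeff_eq_zero_of_natDegree_lt ((natDegree_coeff_le_tDegreeBound P n).trans_lt hl)

/-- Specialising `t ↦ c` is the finite Taylor sum `Σ_l c^l • tCoeff l P`. [folklore] -/
theorem map_evalRingHom_eq_sum (P : MvPolynomial ι R[X]) (c : R) {D : ℕ} (hD : tDegreeBound P ≤ D) :
    map (Polynomial.evalRingHom c) P = ∑ l ∈ Finset.range (D + 1), c ^ l • tCoeff l P := by
  ext n
  rw [coeff_map, coeff_sum, Polynomial.coe_evalRingHom,
    Polynomial.eval_eq_sum_range' ((natDegree_coeff_le_tDegreeBound P n).trans hD |>.trans_lt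
      (Nat.lt_succ_self D))]
  refine Finset.sum_congr rfl fun l _ => ?_
  rw [coeff_smul, coeff_tCoeff, smul_eq_mul, mul_comm]

/-- `tCoeff 0` is the specialisation `t ↦ 0`. [folklore] -/
theorem tCoeff_zero_eq_map_evalRingHom (P : MvPolynomial ι R[X]) :
    tCoeff 0 P = map (Polynomial.evalRingHom 0) P := by
  ext n
  rw [coeff_tCoeff, coeff_map, Polynomial.coe_evalRingHom, Polynomial.coeff_zero_eq_eval_zero]

/-- **`E_ij^(0) = 1`**: the `t^0`-coefficient of `u_ij(t) · F` is `u_ij(0) · F = F`. [folklore] -/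
theorem coordDivPow_zero (m : ℕ) {i j : σ} (h : i ≠ j) :
    (coordDivPow m i j 0 : MvPolynomial (DegIdx σ m) R →ₗ[R] _) = LinearMap.id := by
  refine LinearMap.ext fun F => ?_
  rw [coordDivPow_apply m h, tCoeff_zero_eq_map_evalRingHom, map_coordSubst,
    generalLinearGroup_map_transvectionGL, map_map, Polynomial.coe_evalRingHom, Polynomial.eval_X]
  have hcomp : (Polynomial.evalRingHom (0 : R)).comp (algebraMap R R[X]) = RingHom.id R := by
    ext x; simp
  have h1 : transvectionGL h (0 : R) = 1 := Units.ext (by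
    rw [coe_transvectionGL, Matrix.transvection_zero, Units.val_one])
  rw [hcomp, map_id, h1, coordSubst_one, AlgHom.id_apply, LinearMap.id_apply]

end BaseChange

section MapDivPow

variable {σ : Type*} [Fintype σ] [DecidableEq σ] {R S : Type*} [CommRing R] [CommRing S]

/-- **The divided powers commute with change of scalars** (they are defined over `ℤ`):
`map φ (E_ij^(l) F) = E_ij^(l) (map φ F)`. [cite: Jantzen2003, I.7.8 and II.1.12] -/
theorem map_coordDivPow (φ : R →+* S) (m : ℕ) (i j : σ) (l : ℕ) (F : MvPolynomial (DegIdx σ m) R) :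
    map φ (coordDivPow m i j l F) = coordDivPow m i j l (map φ F) := by
  by_cases h : i = j
  · subst h; simp only [coordDivPow_self, LinearMap.zero_apply, map_zero]
  rw [coordDivPow_apply m h, coordDivPow_apply m h, map_tCoeff, map_coordSubst,
    generalLinearGroup_map_transvectionGL, Polynomial.coe_mapRingHom, Polynomial.map_X, map_map,
    map_map]
  have hcomp : (Polynomial.mapRingHom φ).comp (algebraMap R R[X]) = (algebraMap S S[X]).comp φ := by
    ext x
    simp
  rw [hcomp]

end MapDivPow

section Vandermonde

variable {k V : Type*} [Field k] [AddCommGroup V] [Module k V]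

/-- **Vandermonde extraction.** If `Σ_{l ≤ D} c_i^l • w_l ∈ S` for `D + 1` distinct scalars
`c_i`, then each `w_l ∈ S` (`l ≤ D`): invert the Vandermonde system by Lagrange interpolation.
[folklore] -/
theorem mem_of_sum_pow_smul_mem (S : Submodule k V) {D : ℕ} (w : ℕ → V) (c : Fin (D + 1) → k)
    (hc : Function.Injective c) (h : ∀ i, ∑ l ∈ Finset.range (D + 1), c i ^ l • w l ∈ S)
    {l : ℕ} (hl : l < D + 1) : w l ∈ S := by
  classical
  have hvs : Set.InjOn c (Finset.univ : Finset (Fin (D + 1))) := hc.injOn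
  -- `a i` := the `X^l`-coefficient of the `i`-th Lagrange basis polynomial at the nodes `c`
  set a : Fin (D + 1) → k := fun i => (Lagrange.basis Finset.univ c i).coeff l with ha
  have key : ∀ l' < D + 1, ∑ i, a i * c i ^ l' = if l = l' then 1 else 0 := by
    intro l' hl'
    have hdeg : ((Polynomial.X : k[X]) ^ l').degree <
        (Finset.univ : Finset (Fin (D + 1))).card := by
      rw [Polynomial.degree_X_pow, Finset.card_univ, Fintype.card_fin]
      exact_mod_cast hl'
    have hint := congrArg (fun q : k[X] => q.coeff l) (Lagrange.eq_interpolate hvs hdeg)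
    simp only [Polynomial.coeff_X_pow, Lagrange.interpolate_apply, Polynomial.finsetSum_coeff,
      Polynomial.coeff_C_mul, Polynomial.eval_pow, Polynomial.eval_X] at hint
    rw [hint]
    exact Finset.sum_congr rfl fun i _ => mul_comm _ _
  have hw : w l = ∑ i, a i • ∑ l' ∈ Finset.range (D + 1), c i ^ l' • w l' := by
    simp_rw [Finset.smul_sum, smul_smul]
    rw [Finset.sum_comm]
    simp_rw [← Finset.sum_smul]
    rw [Finset.sum_eq_single_of_mem l (Finset.mem_range.2 hl)]
    · rw [key l hl, if_pos rfl, one_smul]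
    · intro l' hl' hne
      rw [key l' (Finset.mem_range.1 hl'), if_neg (Ne.symm hne), zero_smul]
  rw [hw]
  exact S.sum_mem fun i _ => S.smul_mem _ (h i)

end Vandermonde

section Stability

variable {σ : Type*} [Fintype σ] [DecidableEq σ] {k : Type*} [Field k]

/-- `Λ_{f,d} = ℤ[V]_d ⧸ K_{f,d} ≃ Λ(f,d) ⊆ k[Δ f]` (first isomorphism theorem). [folklore] -/
def orbitLatticeDegEquiv (f : MvPolynomial σ k) (m d : ℕ) :
    OrbitLatticeDeg f m d ≃ₗ[ℤ] orbitIntLatticeDeg f m d :=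
  (LinearMap.quotKerEquivRange
      ((intClassMap f m).toLinearMap ∘ₗ (homogeneousSubmodule (DegIdx σ m) ℤ d).subtype)).trans
    (LinearEquiv.ofEq _ _ (by rw [LinearMap.range_comp, Submodule.range_subtype]; rfl))


/-- The hyperalgebra preserves the vanishing ideal of an orbit: over an infinite field, each
`t^l`-coefficient of `u_ij(t) · F` lies in `I(GL·f)` when `F` does (because `u_ij(c) · F ∈ I`
for every `c ∈ k`, and a polynomial identity in `t` can be un-mixed at `deg + 1` distinct points).
[cite: Jantzen2003, I.7.8 and II.1.12] -/
theorem tCoeff_coordSubst_transvection_mem [Infinite k] {f : MvPolynomial σ k} {m : ℕ}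
    {i j : σ} (h : i ≠ j) {F : MvPolynomial (DegIdx σ m) k} (hF : F ∈ orbitVanishingIdeal f m)
    (l : ℕ) :
    tCoeff l (coordSubst m (transvectionGL h (Polynomial.X : k[X]))
      (map (Polynomial.C : k →+* k[X]) F)) ∈ orbitVanishingIdeal f m := by
  set P := coordSubst m (transvectionGL h (Polynomial.X : k[X])) (map (Polynomial.C : k →+* k[X]) F)
    with hP
  -- enough nodes
  set D := max l (tDegreeBound P) with hD
  let c : Fin (D + 1) → k := fun n => Infinite.natEmbedding k n
  have hc : Function.Injective c := fun a b hab =>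
    Fin.ext (by exact_mod_cast (Infinite.natEmbedding k).injective hab)
  refine mem_of_sum_pow_smul_mem ((orbitVanishingIdeal f m).restrictScalars k) (fun l => tCoeff l P)
    c hc (fun n => ?_) (Nat.lt_succ_of_le (le_max_left _ _))
  -- the Taylor sum at `c n` is `u_ij(c n) · F ∈ I`
  rw [Submodule.restrictScalars_mem, ← map_evalRingHom_eq_sum P (c n) (le_max_right _ _), hP,
    map_coordSubst, generalLinearGroup_map_transvectionGL, map_map, Polynomial.coe_evalRingHom,
    Polynomial.eval_X]
  have hcomp : (Polynomial.evalRingHom (c n)).comp (Polynomial.C : k →+* k[X]) = RingHom.id k := by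
    ext x; simp
  rw [hcomp, map_id]
  have := Ideal.mem_map_of_mem (coordSubst m (transvectionGL h (c n))) hF
  rwa [orbitVanishingIdeal_map_coordSubst] at this

/-- **`K_f` is stable under the hyperalgebra**: the integer coordinate forms vanishing on
`GL(k) · f` are preserved by every `E_ij^(n)` (over an infinite field `k`, e.g. `ℂ`). Hence the
integral lattice `Λ_f = ℤ[V] ⧸ K_f` is a quotient Kostant module (`orbitKostantModule`).
[cite: Jantzen2003, I.7.8 and II.1.12] -/
theorem isStable_orbitLatticeKer [Infinite k] (f : MvPolynomial σ k) (m : ℕ) :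
    (coordKostantModule σ ℤ m).IsStable (orbitLatticeKer f m) := by
  intro i j n F hF
  rw [Submodule.mem_comap, coordKostantModule_divPow]
  by_cases hij : i = j
  · subst hij
    rw [coordDivPow_self, LinearMap.zero_apply]
    exact Submodule.zero_mem _
  rw [mem_orbitLatticeKer_iff] at hF ⊢
  rw [coordDivPow_apply m hij, map_tCoeff, map_coordSubst, generalLinearGroup_map_transvectionGL,
    Polynomial.coe_mapRingHom, Polynomial.map_X, map_map]
  have hcomp : (Polynomial.mapRingHom (Int.castRingHom k)).comp (algebraMap ℤ ℤ[X]) =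
      (Polynomial.C : k →+* k[X]).comp (Int.castRingHom k) :=
    RingHom.ext_int _ _
  rw [hcomp, ← map_map]
  exact tCoeff_coordSubst_transvection_mem hij hF n

/-- Hence `K_{f,d}` is stable in the degree-`d` Kostant module `ℤ[V]_d`. [folklore] -/
theorem isStable_orbitLatticeKerDeg [Infinite k] (f : MvPolynomial σ k) (m d : ℕ) :
    (coordKostantModuleDeg σ ℤ m d).IsStable (orbitLatticeKerDeg f m d) := fun i j n _ hF =>
  isStable_orbitLatticeKer f m i j n hF

/-- **The integral lattice `Λ_{f,d}` of `k[Δ f]_d` as a Kostant module** (quotient of the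
degree-`d` coordinate-form module `ℤ[Sym^m]_d` by the stable submodule `K_{f,d}`): the
`U_ℤ(gl_σ)`-structure on the admissible lattice of classes of integer degree-`d` forms, induced
from `orbitCoordRepDeg f m d`. [cite: Jantzen2003, I.7.8 and II.1.12] -/
def orbitKostantModule [Infinite k] (f : MvPolynomial σ k) (m d : ℕ) :
    KostantModule ℤ σ (OrbitLatticeDeg f m d) :=
  (coordKostantModuleDeg σ ℤ m d).quotient (orbitLatticeKerDeg f m d)
    (isStable_orbitLatticeKerDeg f m d)

end Stability

section StabilityOrdered

variable {σ : Type*} [Fintype σ] [LinearOrder σ] {k : Type*} [Field k] [Infinite k]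

/-- `d_p(f; d, λ)` IS the torsion rank of the Kostant module `Λ_{f,d}`. [folklore] -/
theorem orbitTorsionRank_eq_torsionRank (f : MvPolynomial σ k) (m d p : ℕ) (μ : σ → ℤ) :
    orbitTorsionRank f m d p μ = (orbitKostantModule f m d).torsionRank p μ :=
  (coordKostantModuleDeg σ ℤ m d).presentedTorsionRank_eq _ (isStable_orbitLatticeKerDeg f m d) p μ

end StabilityOrdered

end Literature.RepresentationTheory.GeneralLinear
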